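import Literature.AlgebraicTopology.Homotopy.IteratedSuspension
import HarnessLib

/-!
# Functoriality and Hausdorffness of the unreduced suspension

Topic `Literature/AlgebraicTopology/Homotopy`. A. Hatcher, *Algebraic Topology* (2002), Ch. 0
p. 8–9: the (unreduced) suspension `SX = X × I / (X × {0}, X × {1})` is a functor — a map
`f : X → Y` induces `Sf : SX → SY`, `Sf[x, t] = [f x, t]` ("suspension of maps") — and p. 9,
the suspension of a compact Hausdorff space is compact Hausdorff. For the tree's `Susp` of
`UnreducedSuspension.lean` this file DEFINES `Susp.map` and PROVES:

* `Susp.map f : C(Susp P, Susp Q)`, with `map_mk`, `height_map`, `map_id`, `map_comp`,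
  `map_surjective`, `map_injective`; `Susp.mapHomeomorph e : Susp P ≃ₜ Susp Q` for `e : P ≃ₜ Q`;
* `Susp.mk_zero_eq`, `Susp.mk_one_eq` — the two cone points;
* `Susp.eq_mk_zero_of_height`, `eq_mk_one_of_height` (Hausdorffness of `Susp P` for `P`
  Hausdorff is the tree's `Susp.instT2Space`, `IteratedSuspension.lean`);
* `Susp.isClosedEmbedding_map` — for `P` compact and `Q` Hausdorff, `Susp.map` of an injective
  map is a closed embedding; `Susp.isQuotientMap_map` — of a surjective map is a quotient map.

Everything is proved; no named facts.

## References

* A. Hatcher, *Algebraic Topology*, CUP (2002), Ch. 0 pp. 8–9. [HatcherAT2002]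
-/

noncomputable section

open Set Function Topology unitInterval
open scoped Topology unitInterval

universe u v w

namespace Literature.AlgebraicTopology.Homotopy

namespace Susp

variable {P : Type u} {Q : Type v} {R : Type w}

/-! ### The two cone points -/

/-- All points of height `0` coincide (the south cone point). [cite: HatcherAT2002, Ch. 0 p. 8] -/
theorem mk_zero_eq (p p' : P) : mk (p, (0 : I)) = mk (p', 0) :=
  mk_eq_mk_iff.2 (Or.inr (Or.inl ⟨rfl, rfl⟩))

/-- All points of height `1` coincide (the north cone point). [cite: HatcherAT2002, Ch. 0 p. 8] -/
theorem mk_one_eq (p p' : P) : mk (p, (1 : I)) = mk (p', 1) :=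
  mk_eq_mk_iff.2 (Or.inr (Or.inr ⟨rfl, rfl⟩))

/-- Two points with the same height `t` and, if `0 < t < 1`, the same `P`-coordinate are equal.
[folklore] -/
theorem mk_eq_mk_of_snd_eq {p p' : P} {t : I} (h : t ≠ 0 → t ≠ 1 → p = p') : mk (p, t) = mk (p', t) := by
  by_cases h0 : t = 0
  · subst h0; exact mk_zero_eq p p'
  by_cases h1 : t = 1
  · subst h1; exact mk_one_eq p p'
  rw [h h0 h1]

/-! ### Functoriality -/

section Map

variable [TopologicalSpace P] [TopologicalSpace Q] [TopologicalSpace R]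

/-- **The suspension `Sf : SP → SQ` of a map**, `Sf [p, t] = [f p, t]` (Hatcher 2002, Ch. 0
p. 9). [cite: HatcherAT2002, Ch. 0 p. 9] -/
def map (f : C(P, Q)) : C(Susp P, Susp Q) where
  toFun := Quotient.map' (fun x : P × I => (f x.1, x.2)) fun x y h => by
    rcases h with rfl | ⟨hx, hy⟩ | ⟨hx, hy⟩
    · exact Or.inl rfl
    · exact Or.inr (Or.inl ⟨hx, hy⟩)
    · exact Or.inr (Or.inr ⟨hx, hy⟩)
  continuous_toFun := by
    rw [isQuotientMap_mk.continuous_iff]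
    exact continuous_mk.comp (f.continuous.prodMap continuous_id)

/-- `Sf [p, t] = [f p, t]`. [folklore] -/
@[simp]
theorem map_mk (f : C(P, Q)) (x : P × I) : map f (mk x) = mk (f x.1, x.2) := rfl

/-- `Sf` preserves the height. [folklore] -/
@[simp]
theorem height_map (f : C(P, Q)) (z : Susp P) : height (map f z) = height z := by
  induction z using Susp.ind with
  | h x => rfl

/-- `S(𝟙) = 𝟙`. [folklore] -/
theorem map_id : map (ContinuousMap.id P) = ContinuousMap.id (Susp P) := by
  ext z
  induction z using Susp.ind with
  | h x => rfl

/-- `S(g ∘ f) = Sg ∘ Sf`. [folklore] -/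
theorem map_comp (g : C(Q, R)) (f : C(P, Q)) : map (g.comp f) = (map g).comp (map f) := by
  ext z
  induction z using Susp.ind with
  | h x => rfl

/-- `S(g ∘ f) z = Sg (Sf z)`. [folklore] -/
theorem map_map (g : C(Q, R)) (f : C(P, Q)) (z : Susp P) : map g (map f z) = map (g.comp f) z := by
  rw [map_comp]; rfl

/-- `Sf` is onto when `f` is. [folklore] -/
theorem map_surjective {f : C(P, Q)} (hf : Surjective f) : Surjective (map f) := by
  intro z
  induction z using Susp.ind with
  | h y =>
    obtain ⟨p, hp⟩ := hf y.1
    exact ⟨mk (p, y.2), by rw [map_mk, hp]⟩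

/-- `Sf` is one-to-one when `f` is. [folklore] -/
theorem map_injective {f : C(P, Q)} (hf : Injective f) : Injective (map f) := by
  intro z z' h
  induction z using Susp.ind with
  | h x =>
    induction z' using Susp.ind with
    | h x' =>
      rw [map_mk, map_mk] at h
      have ht : x.2 = x'.2 := by have := snd_eq_of_mk_eq h; exact this
      obtain ⟨p, t⟩ := x
      obtain ⟨p', t'⟩ := x'
      simp only at ht
      subst ht
      refine mk_eq_mk_of_snd_eq fun h0 h1 => hf ?_
      have := eq_of_mk_eq h h0 h1
      simpa using congrArg Prod.fst this

/-- **The suspension of a homeomorphism is a homeomorphism.** [folklore] -/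
def mapHomeomorph (e : P ≃ₜ Q) : Susp P ≃ₜ Susp Q where
  toFun := map (e : C(P, Q))
  invFun := map (e.symm : C(Q, P))
  left_inv z := by
    rw [map_map]
    have : (e.symm : C(Q, P)).comp (e : C(P, Q)) = ContinuousMap.id P :=
      ContinuousMap.ext fun p => e.symm_apply_apply p
    rw [this, map_id]; rfl
  right_inv z := by
    rw [map_map]
    have : (e : C(P, Q)).comp (e.symm : C(Q, P)) = ContinuousMap.id Q :=
      ContinuousMap.ext fun q => e.apply_symm_apply q
    rw [this, map_id]; rfl
  continuous_toFun := (map (e : C(P, Q))).continuous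
  continuous_invFun := (map (e.symm : C(Q, P))).continuous

/-- `mapHomeomorph e` is `S e` as a function. [folklore] -/
@[simp]
theorem coe_mapHomeomorph (e : P ≃ₜ Q) : ⇑(mapHomeomorph e) = map (e : C(P, Q)) := rfl

end Map

/-! ### Points of height `0` and `1` -/

section T2

variable [TopologicalSpace P]

/-- A point of height `0` is the south cone point `[p, 0]`. [folklore] -/
theorem eq_mk_zero_of_height {z : Susp P} (hz : height z = 0) (p : P) : z = mk (p, 0) := by
  induction z using Susp.ind with
  | h x =>
    have hx : x.2 = 0 := hz
    obtain ⟨q, t⟩ := x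
    simp only at hx
    subst hx
    exact mk_zero_eq q p

/-- A point of height `1` is the north cone point `[p, 1]`. [folklore] -/
theorem eq_mk_one_of_height {z : Susp P} (hz : height z = 1) (p : P) : z = mk (p, 1) := by
  induction z using Susp.ind with
  | h x =>
    have hx : x.2 = 1 := hz
    obtain ⟨q, t⟩ := x
    simp only at hx
    subst hx
    exact mk_one_eq q p

end T2

/-! ### Closed embeddings and quotient maps -/

section Compact

variable [TopologicalSpace P] [TopologicalSpace Q]

/-- **`Sf` is a closed embedding** for `f` one-to-one, `P` compact, `Q` Hausdorff. [folklore] -/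
theorem isClosedEmbedding_map [CompactSpace P] [T2Space Q] {f : C(P, Q)} (hf : Injective f) :
    IsClosedEmbedding (map f) :=
  (map f).continuous.isClosedEmbedding (map_injective hf)

/-- **`Sf` is a quotient map** for `f` onto, `P` compact, `Q` Hausdorff. [folklore] -/
theorem isQuotientMap_map [CompactSpace P] [T2Space Q] {f : C(P, Q)} (hf : Surjective f) :
    IsQuotientMap (map f) :=
  ((map f).continuous.isClosedMap).isQuotientMap (map f).continuous (map_surjective hf)

end Compact


end Susp

end Literature.AlgebraicTopology.Homotopy

end
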